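import Literature.MathematicalPhysics.QuantumManyBody.PeriodicBoseGas
import Literature.MathematicalPhysics.QuantumManyBody.PeriodizedPotentialNearestImage
import Literature.MathematicalPhysics.QuantumManyBody.PeriodicGroundStateFeynmanKacProofs
import Literature.MathematicalPhysics.QuantumManyBody.PeriodicKyFanGapFeynmanKac
import Literature.MathematicalPhysics.QuantumManyBody.PeriodicClusteringFromKyFanGap

/-!
# Route `BECThomsonPrinciple`, crux `PeriodicToDirichlet` (stmt-AtomisticToContinuum-9483),
# line `Sketch` (torus-in-the-box-doob): registered stub `stub_torusInterfaceBounded` (P_T)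

The torus half of the Doob line's ground-state pair: for a BOUNDED admissible pair potential `w` and
every density `ρ > 0`, for all large `N = m+1` the torus ground-state interface on the cell of side
`L_N = (N/ρ)^{1/3}` is inhabited — a continuous, lattice-periodic, rigidly translation-invariant,
nonnegative, cell-normalised `Φ` that is the `L²(cell)`-limit up to phase of ALL periodic
`δ`-near-minimisers as `δ → 0`. Source in the tree: the Feynman–Kac ground state
(`PeriodicGroundStateFeynmanKac_holds`), its uniqueness (`IsPeriodicGroundStateFK.unique`, which
with the translation covariance of the torus Feynman–Kac functional gives rigid-translation
invariance), the two-level Rayleigh bound of the semigroup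
(`IsPeriodicGroundStateFK.exists_twoLevel`: the spectral gap below the simple ground state) and its
variational reading (`ofReal_le_periodicEnergy_of_twoLevel`:
`E₀ + γ (1 - |⟨Φ, Ψ⟩_cell|²) ≤ 𝓔^per[Ψ]`), whence
`∫_cell |Ψ - e^{iθ}Φ|² = 2 - 2|⟨Φ, Ψ⟩_cell| ≤ 2δ/γ` for every `δ`-near-minimiser `Ψ`. [folklore]
-/

noncomputable section

open MeasureTheory Filter
open scoped ENNReal NNReal ComplexConjugate

namespace Summit.AtomisticToContinuum.BoseEinsteinCondensation.TorusInTheBox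

open Literature.MathematicalPhysics.QuantumManyBody.BoseGas

/-! ### Private helpers -/

/-- `L_N = (N/ρ)^{1/3} → ∞` along `N = m + 1`. [folklore] -/
private theorem tendsto_sideLength_succ {ρ : ℝ} (hρ : 0 < ρ) :
    Tendsto (fun m : ℕ => sideLength ρ (m + 1)) atTop atTop := by
  have h : Tendsto (fun n : ℕ => sideLength ρ n) atTop atTop := by
    unfold sideLength
    exact (tendsto_rpow_atTop (by norm_num : (0 : ℝ) < 1 / 3)).comp
      (tendsto_natCast_atTop_atTop.atTop_div_const hρ)
  exact h.comp (tendsto_add_atTop_nat 1)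

/-- The `[0,∞]`-valued torus Feynman–Kac functional is covariant under a common translation of all
particles: `(e^{-TH} g)(X + (u,…,u)) = (e^{-TH} g(· + (u,…,u)))(X)`. [folklore] -/
private theorem periodicFKSemigroup_add_const {N : ℕ} (v : ℝ → ℝ≥0∞) (L T : ℝ)
    (g : Config N → ℝ≥0∞) (X : Config N) (u : Space) :
    periodicFKSemigroup v L T g (X + fun _ => u) =
      periodicFKSemigroup v L T (fun Y => g (Y + fun _ => u)) X := by
  simp only [periodicFKSemigroup, periodicFKWeight_add_const, worldLine_add_right]

/-- **A rigid translate of a Feynman–Kac ground state is a Feynman–Kac ground state** (`L > 0`): the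
torus Feynman–Kac functional commutes with common translations of all particles, and cell integrals
of periodic functions are shift invariant. [folklore] -/
private theorem isPeriodicGroundStateFK_comp_add_const {N : ℕ} {v : ℝ → ℝ≥0∞} {L : ℝ}
    (hL : 0 < L) {Φ : Config N → ℝ} (h : IsPeriodicGroundStateFK v L Φ) (a : Space) :
    IsPeriodicGroundStateFK v L (fun X => Φ (X + fun _ => a)) := by
  have hperA : ∀ (X : Config N) (i : Fin N) (k : Fin 3),
      Φ (X + Pi.single i (EuclideanSpace.single k L) + fun _ => a) = Φ (X + fun _ => a) :=
    fun X i k => by rw [add_right_comm, h.periodic]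
  refine ⟨?_, fun X => h.nonneg _, hperA, ?_, ?_, h.energy_ne_top, ?_, ?_⟩
  · exact h.measurable.comp (measurable_add_const _)
  · intro σ X
    show Φ ((X ∘ ⇑σ) + fun _ => a) = Φ (X + fun _ => a)
    have : ((X ∘ ⇑σ) + fun _ => a) = (X + fun _ => a) ∘ ⇑σ := rfl
    rw [this, h.symm]
  · have := lintegral_cellN_comp_add hL (G := fun X => ENNReal.ofReal (Φ X) ^ 2)
      (fun X i k => by simp only [h.periodic]) (fun _ => a)
    rw [← h.norm_eq, ← this]
  · intro T hT X
    have := h.eigen T hT (X + fun _ => a)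
    rwa [periodicFKSemigroup_add_const] at this
  · intro g hg hgper hg2 X
    show Tendsto (fun T : ℝ =>
        ENNReal.ofReal (Real.exp ((periodicGroundStateEnergy v N L).toReal * T)) *
          periodicFKSemigroup v L T g X) atTop
      (nhds ((∫⁻ Y in cellN N L, ENNReal.ofReal (Φ (Y + fun _ => a)) * g Y) *
        ENNReal.ofReal (Φ (X + fun _ => a))))
    have hg'm : Measurable fun Y : Config N => g (Y - fun _ => a) :=
      hg.comp (measurable_sub_const _)
    have hg'per : ∀ (Y : Config N) (i : Fin N) (k : Fin 3),
        g (Y + Pi.single i (EuclideanSpace.single k L) - fun _ => a) = g (Y - fun _ => a) :=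
      fun Y i k => by rw [add_sub_right_comm, hgper]
    have hg'2 : ∫⁻ Y in cellN N L, g (Y - fun _ => a) ^ 2 ≠ ⊤ := by
      have := lintegral_cellN_comp_add hL (G := fun Y => g Y ^ 2)
        (fun Y i k => by simp only [hgper]) (-fun _ => a)
      simp only [← sub_eq_add_neg] at this
      rwa [this]
    have key := h.tendsto (fun Y => g (Y - fun _ => a)) hg'm hg'per hg'2 (X + fun _ => a)
    have h1 : ∀ T : ℝ,
        periodicFKSemigroup v L T (fun Y => g (Y - fun _ => a)) (X + fun _ => a) =
          periodicFKSemigroup v L T g X := fun T => by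
      rw [periodicFKSemigroup_add_const]
      simp only [add_sub_cancel_right]
    have h2 : ∫⁻ Y in cellN N L, ENNReal.ofReal (Φ Y) * g (Y - fun _ => a) =
        ∫⁻ Y in cellN N L, ENNReal.ofReal (Φ (Y + fun _ => a)) * g Y := by
      have := lintegral_cellN_comp_add hL
        (G := fun Y => ENNReal.ofReal (Φ Y) * g (Y - fun _ => a))
        (fun Y i k => by simp only [h.periodic, hg'per]) (fun _ => a)
      simp only [add_sub_cancel_right] at this
      exact this.symm
    simp only [h1, h2] at key
    exact key

/-- `∫ ‖F - G‖² = ∫ ‖F‖² - 2 Re ∫ conj F · G + ∫ ‖G‖²` for `F, G ∈ L²(μ; ℂ)`. [folklore] -/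
private theorem integral_norm_sub_sq_eq {α : Type*} [MeasurableSpace α] {μ : Measure α}
    {F G : α → ℂ} (hF : MemLp F 2 μ) (hG : MemLp G 2 μ) :
    ∫ x, ‖F x - G x‖ ^ 2 ∂μ =
      (∫ x, ‖F x‖ ^ 2 ∂μ) - 2 * (∫ x, conj (F x) * G x ∂μ).re + ∫ x, ‖G x‖ ^ 2 ∂μ := by
  have hpt : ∀ x, ‖F x - G x‖ ^ 2 = (‖F x‖ ^ 2 - 2 * (conj (F x) * G x).re) + ‖G x‖ ^ 2 := by
    intro x
    rw [@norm_sub_sq ℂ, RCLike.inner_apply', RCLike.re_to_complex]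
  have hFc : MemLp (fun x => conj (F x)) 2 μ :=
    hF.of_le (Complex.continuous_conj.comp_aestronglyMeasurable hF.1)
      (Eventually.of_forall fun x => by rw [Complex.norm_conj])
  have hFG : Integrable (fun x => conj (F x) * G x) μ := hFc.integrable_mul hG
  have hF2 : Integrable (fun x => ‖F x‖ ^ 2) μ := hF.norm.integrable_sq
  have hG2 : Integrable (fun x => ‖G x‖ ^ 2) μ := hG.norm.integrable_sq
  have hre : Integrable (fun x => 2 * (conj (F x) * G x).re) μ := by
    have := hFG.re.const_mul 2
    simpa only [RCLike.re_to_complex] using this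
  have hre_eq : ∫ x, (conj (F x) * G x).re ∂μ = (∫ x, conj (F x) * G x ∂μ).re := by
    have := integral_re hFG
    simpa only [RCLike.re_to_complex] using this
  simp_rw [hpt]
  rw [integral_add (f := fun x => ‖F x‖ ^ 2 - 2 * (conj (F x) * G x).re) (g := fun x => ‖G x‖ ^ 2)
      (hF2.sub hre) hG2,
    integral_sub (f := fun x => ‖F x‖ ^ 2) (g := fun x => 2 * (conj (F x) * G x).re) hF2 hre,
    integral_const_mul, hre_eq]

/-- **The distance to the ground state up to a phase**: for a periodic trial state `Ψ`, a real
`Φ ∈ L²(cell)` with `∫_cell Φ² = 1`, `s = ∫_cell conj Ψ · Φ` and the phase `θ = -arg s`,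
`∫_cell |Ψ - e^{iθ}Φ|² = 2 - 2|s|`. [folklore] -/
private theorem integral_norm_sub_phase_mul_sq {N : ℕ} {L : ℝ} (Ψ : PeriodicTrialState N L)
    {Φ : Config N → ℝ} (hΦ : MemLp Φ 2 (volume.restrict (cellN N L)))
    (hΦ1 : ∫ X in cellN N L, Φ X ^ 2 = 1) :
    ∫ X in cellN N L, ‖Ψ.ψ X -
        Complex.exp (↑(-(Complex.arg (∫ Y in cellN N L, conj (Ψ.ψ Y) * (Φ Y : ℂ)))) * Complex.I) *
          (Φ X : ℂ)‖ ^ 2 =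
      2 - 2 * ‖∫ Y in cellN N L, conj (Ψ.ψ Y) * (Φ Y : ℂ)‖ := by
  set s : ℂ := ∫ Y in cellN N L, conj (Ψ.ψ Y) * (Φ Y : ℂ) with hs
  set c : ℂ := Complex.exp (↑(-(Complex.arg s)) * Complex.I) with hc
  have hc1 : ‖c‖ = 1 := Complex.norm_exp_ofReal_mul_I _
  have hcs : c * s = (‖s‖ : ℂ) := by
    conv_lhs => rw [← Complex.norm_mul_exp_arg_mul_I s]
    rw [hc, mul_left_comm, ← Complex.exp_add]
    have : (↑(-(Complex.arg s)) : ℂ) * Complex.I + ↑(Complex.arg s) * Complex.I = 0 := by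
      push_cast; ring
    rw [this, Complex.exp_zero, mul_one]
  have hG : MemLp (fun X => c * (Φ X : ℂ)) 2 (volume.restrict (cellN N L)) :=
    (hΦ.ofReal (K := ℂ)).const_mul c
  rw [integral_norm_sub_sq_eq Ψ.memLp_two hG]
  -- `∫ ‖Ψ‖² = 1`
  have h1 : ∫ X in cellN N L, ‖Ψ.ψ X‖ ^ 2 = 1 := by
    rw [integral_cellN_norm_sq_eq_toReal L Ψ.contDiff.continuous, Ψ.norm_eq, ENNReal.toReal_one]
  -- `∫ ‖cΦ‖² = 1`
  have h2 : ∫ X in cellN N L, ‖c * (Φ X : ℂ)‖ ^ 2 = 1 := by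
    rw [← hΦ1]
    refine integral_congr_ae (Eventually.of_forall fun X => ?_)
    simp only [norm_mul, hc1, one_mul, Complex.norm_real, Real.norm_eq_abs, sq_abs]
  -- `∫ conj Ψ · cΦ = c s = |s|`
  have h3 : ∫ X in cellN N L, conj (Ψ.ψ X) * (c * (Φ X : ℂ)) = (‖s‖ : ℂ) := by
    rw [← hcs, hs, ← integral_const_mul]
    refine integral_congr_ae (Eventually.of_forall fun X => ?_)
    simp only
    ring
  rw [h1, h2, h3, Complex.ofReal_re]
  ring

/-! ### The stub -/

/-- **Registered stub `stub_torusInterfaceBounded`** (P_T of line `Sketch`, crux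
stmt-AtomisticToContinuum-9483; the skeleton's `TorusInterfaceBounded` with `IsTorusGS` unfolded). [folklore] -/
theorem stub_torusInterfaceBounded :
    ∀ w : ℝ → ℝ≥0∞, IsRepulsiveFiniteRange w → (∃ M : ℝ≥0, ∀ r, w r ≤ M) →
      ∀ ρ : ℝ, 0 < ρ → ∀ᶠ m : ℕ in atTop,
        ∃ Φ : Config (m + 1) → ℝ,
          Continuous Φ ∧
          (∀ (X : Config (m + 1)) (i : Fin (m + 1)) (k : Fin 3),
            Φ (X + Pi.single i (EuclideanSpace.single k (sideLength ρ (m + 1)))) = Φ X) ∧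
          (∀ (a : Space) (X : Config (m + 1)), Φ (fun i => X i + a) = Φ X) ∧
          (∀ X, 0 ≤ Φ X) ∧
          (∫⁻ X in cellN (m + 1) (sideLength ρ (m + 1)), (‖(Φ X : ℂ)‖₊ : ℝ≥0∞) ^ 2 = 1) ∧
          ∀ η : ℝ, 0 < η → ∃ δ : ℝ≥0∞, 0 < δ ∧
            ∀ Ψ : PeriodicTrialState (m + 1) (sideLength ρ (m + 1)),
              periodicEnergy w Ψ ≤ periodicGroundStateEnergy w (m + 1) (sideLength ρ (m + 1)) + δ →
                ∃ θ : ℝ, ∫ X in cellN (m + 1) (sideLength ρ (m + 1)),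
                  ‖Ψ.ψ X - Complex.exp (θ * Complex.I) * (Φ X : ℂ)‖ ^ 2 ≤ η := by
  intro w hw hbdd ρ hρ
  obtain ⟨hwm, R₀, hR₀⟩ := hw
  obtain ⟨M, hM⟩ := hbdd
  filter_upwards [(tendsto_sideLength_succ hρ).eventually_gt_atTop (2 * R₀),
    (tendsto_sideLength_succ hρ).eventually_gt_atTop 0] with m h2R hL
  -- Step (a): the periodisation is bounded by `M` once `2R₀ < L` (a single near image)
  have hC : ∀ x, periodizedPotential w (sideLength ρ (m + 1)) x ≤ (M : ℝ≥0∞) := fun x => by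
    obtain ⟨n₀, hn₀⟩ := exists_periodizedPotential_eq_single hR₀ h2R hL x
    rw [hn₀]
    exact hM _
  -- Step (b): the Feynman–Kac ground state
  obtain ⟨Φ, hΦ, hcont, -⟩ := PeriodicGroundStateFeynmanKac_holds (m + 1) (sideLength ρ (m + 1)) w
    (Nat.succ_le_succ (Nat.zero_le m)) hL hwm ⟨M, hC⟩
  refine ⟨Φ, hcont, hΦ.periodic, fun a X => ?_, hΦ.nonneg, ?_, fun η hη => ?_⟩
  · -- Step (c): rigid-translation invariance by uniqueness of the Feynman–Kac ground state
    exact congrFun ((isPeriodicGroundStateFK_comp_add_const hL hΦ a).unique hΦ) X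
  · -- normalisation in the complex `nnnorm` form
    refine Eq.trans (lintegral_congr fun X => ?_) hΦ.norm_eq
    rw [ennnorm_sq_ofReal_periodic, ENNReal.ofReal_pow (hΦ.nonneg X)]
  · -- Step (d): near-minimisers are close to `Φ` up to a phase (two-level Rayleigh bound)
    obtain ⟨γ, hγ, htwo⟩ := hΦ.exists_twoLevel hwm hL hC
    refine ⟨ENNReal.ofReal (γ * η / 2), ENNReal.ofReal_pos.2 (by positivity), fun Ψ hΨ => ?_⟩
    have hE : periodicGroundStateEnergy w (m + 1) (sideLength ρ (m + 1)) ≠ ⊤ := hΦ.energy_ne_top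
    have hlow := ofReal_le_periodicEnergy_of_twoLevel hL hwm hC
      (fun f => ∫ X in cellN (m + 1) (sideLength ρ (m + 1)), Φ X * f X) (fun k => by positivity)
      (tendsto_pow_atTop_nhds_zero_of_lt_one (by norm_num) (by norm_num)) htwo Ψ
    dsimp only at hlow
    set E₀ : ℝ := (periodicGroundStateEnergy w (m + 1) (sideLength ρ (m + 1))).toReal with hE₀
    set A : ℝ := (∫ X in cellN (m + 1) (sideLength ρ (m + 1)), Φ X * (Ψ.ψ X).re) ^ 2 +
      (∫ X in cellN (m + 1) (sideLength ρ (m + 1)), Φ X * (Ψ.ψ X).im) ^ 2 with hAdef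
    have hA : 1 - A ≤ η / 2 := by
      have h1 : ENNReal.ofReal (E₀ + γ * (1 - A)) ≤ ENNReal.ofReal (E₀ + γ * η / 2) := by
        calc ENNReal.ofReal (E₀ + γ * (1 - A)) ≤ periodicEnergy w Ψ := hlow
          _ ≤ periodicGroundStateEnergy w (m + 1) (sideLength ρ (m + 1)) +
                ENNReal.ofReal (γ * η / 2) := hΨ
          _ = ENNReal.ofReal (E₀ + γ * η / 2) := by
              rw [ENNReal.ofReal_add ENNReal.toReal_nonneg (by positivity),
                ENNReal.ofReal_toReal hE]
      have h2 := (ENNReal.ofReal_le_ofReal_iff (by positivity)).1 h1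
      nlinarith
    -- the overlap `s = ⟨Ψ, Φ⟩_cell`, `|s|² = A`
    set s : ℂ := ∫ Y in cellN (m + 1) (sideLength ρ (m + 1)), conj (Ψ.ψ Y) * (Φ Y : ℂ) with hs
    have hsA : ‖s‖ ^ 2 = A := norm_sq_setIntegral_conj_mul_ofReal hΦ.memLp_two Ψ
    refine ⟨-(Complex.arg s), ?_⟩
    rw [integral_norm_sub_phase_mul_sq Ψ hΦ.memLp_two hΦ.setIntegral_sq]
    by_cases hs1 : ‖s‖ ≤ 1
    · nlinarith [mul_nonneg (sub_nonneg.2 hs1) (norm_nonneg s)]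
    · push Not at hs1
      linarith

end Summit.AtomisticToContinuum.BoseEinsteinCondensation.TorusInTheBox

end
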